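/-
Copyright (c) 2026. All rights reserved.
Released under Apache 2.0 license as described in the file LICENSE.
-/
import Mathlib
import Summits.RiemannHypothesis.RiemannHypothesis.Theorems.HandoffLatticeTailPositive
import Literature.NumberTheory.LFunctions.MuentzFormulaStrip
import HarnessLib

/-!
# THEOREM P for Lipschitz data: `T_λ(F) > 0` and the lattice tail has unbounded depth

`HANDOFF/prove-1` gen15, ATTEMPT-22 §3. The Müntz hypothesis of the abstract THEOREM P
(`dilationSum_not_ae_zero`, file `HandoffLatticeTailPositive`) is discharged by the tree's
`Literature.NumberTheory.LFunctions.mellin_tsum_indicator_comp_mul_nat` (Titchmarsh (2.11.1) with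
`∫ F = 0`) for `F` Lipschitz on `[0, λ]`, vanishing beyond `λ`, with `∫_0^λ F = 0`. Results:

* `dilationSum_not_ae_zero_of_lipschitzOn` — if moreover `F x₀ ≠ 0` for some `x₀ ∈ (0, λ]`, then
  for every `δ > 0` the dilation sum `θ_F` is not a.e. zero on `(0, δ)`;
* `setIntegral_normSq_dilationSum_pos` — `0 < ∫_0^δ ‖θ_F‖²` for every `δ > 0`;
* `latticeTail_pos` — in particular `0 < latticeTail λ F` (the `S₀`-lattice tail of THEOREM U0 /
  THEOREM N / idea-1's (U-LATTICE), (U-PW*)): the deficit functional of the HANDOFF programme never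
  vanishes, and no admissible vector has a tail of finite log-depth (cf. idea-1's (DEPTH),
  IDEAS-prolate §131.3, which must therefore be an approximate statement).
* `intervalIntegral_eq_zero_of_even` — for the EVEN two-sided vectors of the programme
  (`∫_ℝ F = 0`, support in `[-λ, λ]`) the one-sided hypothesis `∫_0^λ F = 0` holds.

The counting mechanism (entire of exponential type ⇒ `O(r)` zeros, against `N(T) ≍ T log T`) is the
RH-free form of the remark in Connes–Consani, *Spectral triples and ζ-cycles* (Enseign. Math.
2023, arXiv:2106.01715), §3 p. 11
(there: for the radical of `QW`, assuming RH; [Rudin] 15.20); the nearest printed relative of the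
conclusion is Burnol, J. Théor. Nombres Bordeaux 16 (2004), Thm 3.1 / Prop. 6.1 (completeness of the
zero-evaluators in the co-Poisson spaces `L_a`, `a ≥ 1`, via Krein's type theorem). RH-free.
Nothing here bears on the truth of RH.
-/

noncomputable section

set_option linter.dupNamespace false

open Complex MeasureTheory Set Filter
open Literature.NumberTheory.LFunctions
open scoped NNReal

namespace Summit.RiemannHypothesis.RiemannHypothesis.Theorems

namespace LatticeUncertainty

variable {lam : ℝ} {F : ℝ → ℂ}

/-! ## The dilation sum as an `ℕ`-indexed series; Müntz for Lipschitz data -/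

/-- For `F` vanishing beyond `λ` and `u > 0`: `θ_F(u) = Σ_{n ≥ 0} F((n+1)u)`. -/
theorem dilationSum_eq_tsum_nat (hFs : ∀ x, lam < x → F x = 0) {u : ℝ} (hu : 0 < u) :
    dilationSum lam F u = ∑' n : ℕ, F ((n + 1 : ℕ) * u) := by
  unfold dilationSum
  set N := ⌊lam / u⌋₊ with hN
  have hzero : ∀ k : ℕ, k ∉ Finset.range N → F ((k + 1 : ℕ) * u) = 0 := by
    intro k hk
    rw [Finset.mem_range, not_lt] at hk
    apply hFs
    have hk' : (N : ℝ) ≤ k := by exact_mod_cast hk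
    have h1 : lam / u < (k : ℝ) + 1 := by linarith [Nat.lt_floor_add_one (lam / u)]
    rw [div_lt_iff₀ hu] at h1
    push_cast
    exact h1
  rw [tsum_eq_sum hzero, ← Finset.Ico_succ_right_eq_Icc, Finset.sum_Ico_eq_sum_range]
  refine Finset.sum_congr (by simp) fun k _ ↦ ?_
  rw [add_comm]

/-- On `(0, ∞)`, `F` agrees with `1_{(0,λ]} F` when `F` vanishes beyond `λ`. -/
theorem indicator_Ioc_eq_self (hFs : ∀ x, lam < x → F x = 0) {x : ℝ} (hx : 0 < x) :
    (Ioc 0 lam).indicator F x = F x := by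
  by_cases h : x ≤ lam
  · exact indicator_of_mem (mem_Ioc.mpr ⟨hx, h⟩) _
  · rw [indicator_of_notMem (fun h' ↦ h (mem_Ioc.mp h').2), hFs x (not_le.mp h)]

/-- The Mellin transform only sees `(0, ∞)`: `𝓜(1_{(0,λ]} F) = 𝓜F` for `F` vanishing beyond `λ`. -/
theorem mellin_indicator_Ioc_eq (hFs : ∀ x, lam < x → F x = 0) (s : ℂ) :
    mellin ((Ioc 0 lam).indicator F) s = mellin F s := by
  unfold mellin
  refine setIntegral_congr_fun measurableSet_Ioi fun x hx ↦ ?_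
  rw [indicator_Ioc_eq_self hFs hx]

/-- The dilation sum of `F` is the tree's `Σ_{n} 1_{(0,λ]}F((n+1)u)` on `(0, ∞)`. -/
theorem dilationSum_eq_tsum_indicator (hFs : ∀ x, lam < x → F x = 0) {u : ℝ} (hu : 0 < u) :
    dilationSum lam F u = ∑' n : ℕ, (Ioc 0 lam).indicator F ((n + 1 : ℕ) * u) := by
  rw [dilationSum_eq_tsum_nat hFs hu]
  refine tsum_congr fun n ↦ ?_
  rw [indicator_Ioc_eq_self hFs (by positivity)]

/-- **Müntz's formula for the dilation sum (L-M1 for Lipschitz data).** For `F` Lipschitz on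
`[0, λ]` (`λ > 0`), vanishing beyond `λ`, with `∫_0^λ F = 0`, and `Re s > 0`, `s ≠ 1`:
`𝓜θ_F(s) = ζ(s)·𝓜F(s)`. [cite: Titchmarsh1986, §2.11 (2.11.1)] -/
theorem mellin_dilationSum_eq_zeta_mul (hlam : 0 < lam) {L : ℝ≥0}
    (hLip : LipschitzOnWith L F (Icc 0 lam)) (hFs : ∀ x, lam < x → F x = 0)
    (hint : ∫ t in (0 : ℝ)..lam, F t = 0) {s : ℂ} (hs : 0 < s.re) (hs1 : s ≠ 1) :
    mellin (dilationSum lam F) s = riemannZeta s * mellin F s := by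
  have h := (mellin_tsum_indicator_comp_mul_nat hlam hLip hint hs hs1).2
  rw [mellin_indicator_Ioc_eq hFs] at h
  rw [← h]
  unfold mellin
  refine setIntegral_congr_fun measurableSet_Ioi fun x hx ↦ ?_
  simp only [dilationSum_eq_tsum_indicator hFs hx]

/-- Boundedness of the dilation sum for such data: `‖θ_F(u)‖ ≤ L·λ + M` (`M` a bound for `‖F‖`
on `[0, λ]`), for all real `u`. -/
theorem norm_dilationSum_le_of_lipschitzOn (hlam : 0 < lam) {L : ℝ≥0} {M : ℝ}
    (hLip : LipschitzOnWith L F (Icc 0 lam)) (hM : ∀ t ∈ Icc 0 lam, ‖F t‖ ≤ M)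
    (hFs : ∀ x, lam < x → F x = 0) (hint : ∫ t in (0 : ℝ)..lam, F t = 0) (u : ℝ) :
    ‖dilationSum lam F u‖ ≤ L * lam + M := by
  have hM0 : 0 ≤ M := (norm_nonneg _).trans (hM 0 ⟨le_rfl, hlam.le⟩)
  rcases le_or_gt u 0 with hu | hu
  · have : ⌊lam / u⌋₊ = 0 := Nat.floor_eq_zero.mpr (by
      have : lam / u ≤ 0 := div_nonpos_of_nonneg_of_nonpos hlam.le hu
      linarith)
    rw [dilationSum, this]
    simp only [show Finset.Icc 1 0 = ∅ by rfl, Finset.sum_empty, norm_zero]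
    positivity
  · rw [dilationSum_eq_tsum_indicator hFs hu]
    exact norm_tsum_indicator_comp_mul_nat_le hlam hLip hM hint hu

/-! ## THEOREM P for Lipschitz data -/

/-- A function continuous on `[0, λ]` that is nonzero at some `x₀ ∈ (0, λ]` is not a.e. zero on
`(0, λ]`. -/
theorem not_ae_eq_zero_of_continuousOn (hcont : ContinuousOn F (Icc 0 lam)) {x₀ : ℝ}
    (hx₀ : x₀ ∈ Ioc 0 lam) (hF : F x₀ ≠ 0) :
    ¬ ∀ᵐ x ∂(volume.restrict (Ioc 0 lam)), F x = 0 := by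
  intro h
  have hx₀' : x₀ ∈ Icc 0 lam := ⟨hx₀.1.le, hx₀.2⟩
  obtain ⟨η, hη, hηF⟩ := (Metric.continuousWithinAt_iff.mp (hcont x₀ hx₀')) ‖F x₀‖
    (norm_pos_iff.mpr hF)
  -- the interval `S = (max (x₀/2) (x₀ - η/2), x₀)` lies in `(0, λ]` and `F ≠ 0` on it
  set a := max (x₀ / 2) (x₀ - η / 2) with ha
  have hax : a < x₀ := max_lt (by linarith [hx₀.1]) (by linarith)
  have ha0 : 0 < a := lt_max_of_lt_left (by linarith [hx₀.1])
  have hS : Ioo a x₀ ⊆ {x | ¬ (x ∈ Ioc 0 lam → F x = 0)} := by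
    intro x hx hx'
    have hxI : x ∈ Icc 0 lam := ⟨(ha0.trans hx.1).le, hx.2.le.trans hx₀.2⟩
    have hdist : dist x x₀ < η := by
      rw [Real.dist_eq, abs_sub_lt_iff]
      constructor <;> linarith [hx.1, hx.2, le_max_right (x₀ / 2) (x₀ - η / 2)]
    have := hηF hxI hdist
    rw [hx' ⟨ha0.trans hx.1, hx.2.le.trans hx₀.2⟩, dist_zero_left] at this
    exact lt_irrefl _ this
  have hnull : volume {x | ¬ (x ∈ Ioc 0 lam → F x = 0)} = 0 :=
    ae_iff.mp ((ae_restrict_iff' measurableSet_Ioc).mp h)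
  have := measure_mono_null hS hnull
  rw [Real.volume_Ioo, ENNReal.ofReal_eq_zero] at this
  linarith

/-- **THEOREM P (Lipschitz data).** Let `F` be measurable, Lipschitz on `[0, λ]` (`λ > 0`),
vanishing beyond `λ`, with `∫_0^λ F = 0` and `F x₀ ≠ 0` for some `x₀ ∈ (0, λ]`. Then for every
`δ > 0` the dilation sum `θ_F(u) = Σ_{n ≤ λ/u} F(nu)` is NOT a.e. zero on `(0, δ)`: the lattice tail
has unbounded log-depth. (Values of `F` on `(-∞, 0]` play no role.) -/
theorem dilationSum_not_ae_zero_of_lipschitzOn (hlam : 0 < lam) {L : ℝ≥0}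
    (hLip : LipschitzOnWith L F (Icc 0 lam)) (hFm : Measurable F) (hFs : ∀ x, lam < x → F x = 0)
    (hint : ∫ t in (0 : ℝ)..lam, F t = 0) {x₀ : ℝ} (hx₀ : x₀ ∈ Ioc 0 lam) (hF : F x₀ ≠ 0)
    {δ : ℝ} (hδ : 0 < δ) :
    ¬ ∀ᵐ u ∂(volume.restrict (Ioo 0 δ)), dilationSum lam F u = 0 := by
  -- work with the one-sided restriction `F₁ = 1_{(0,λ]} F`
  set F₁ : ℝ → ℂ := (Ioc 0 lam).indicator F with hF₁
  obtain ⟨M, hM⟩ : ∃ M, ∀ t ∈ Icc 0 lam, ‖F t‖ ≤ M :=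
    isCompact_Icc.exists_bound_of_continuousOn hLip.continuousOn
  have hM0 : 0 ≤ M := (norm_nonneg _).trans (hM 0 ⟨le_rfl, hlam.le⟩)
  have hF₁m : Measurable F₁ := hFm.indicator measurableSet_Ioc
  have hF₁b : ∀ x, ‖F₁ x‖ ≤ M := by
    intro x
    by_cases hx : x ∈ Ioc 0 lam
    · rw [hF₁, indicator_of_mem hx]; exact hM x ⟨hx.1.le, hx.2⟩
    · rw [hF₁, indicator_of_notMem hx, norm_zero]; exact hM0
  have hF₁s : ∀ x, x ∉ Ioc 0 lam → F₁ x = 0 := fun x hx ↦ indicator_of_notMem hx _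
  have hF₁s' : ∀ x, lam < x → F₁ x = 0 := fun x hx ↦ hF₁s x fun h ↦ not_lt.mpr h.2 hx
  -- the dilation sums of `F` and `F₁` agree on `(0, ∞)`
  have hdil : ∀ u, 0 < u → dilationSum lam F₁ u = dilationSum lam F u := by
    intro u hu
    rw [dilationSum_eq_tsum_nat hF₁s' hu, dilationSum_eq_tsum_indicator hFs hu]
  -- Müntz for `F₁`
  have hMuntz : ∀ s : ℂ, 0 < s.re → s.re < 1 →
      mellin (dilationSum lam F₁) s = riemannZeta s * mellin F₁ s := by
    intro s hs hs1
    have hs1' : s ≠ 1 := fun h ↦ by rw [h, one_re] at hs1; exact lt_irrefl _ hs1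
    have hmF : mellin F₁ s = mellin F s := by rw [hF₁]; exact mellin_indicator_Ioc_eq hFs s
    rw [hmF, ← mellin_dilationSum_eq_zeta_mul hlam hLip hFs hint hs hs1']
    unfold mellin
    refine setIntegral_congr_fun measurableSet_Ioi fun x hx ↦ ?_
    rw [hdil x hx]
  -- `F₁` is not a.e. zero on `(0, λ]`
  have hne : ¬ ∀ᵐ x ∂(volume.restrict (Ioc 0 lam)), F₁ x = 0 := by
    intro h
    apply not_ae_eq_zero_of_continuousOn hLip.continuousOn hx₀ hF
    rw [ae_restrict_iff' measurableSet_Ioc] at h ⊢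
    filter_upwards [h] with x hx hxI
    rw [← hx hxI, hF₁, indicator_of_mem hxI]
  have key := dilationSum_not_ae_zero hlam hF₁m hF₁b hF₁s hMuntz hne hδ
  intro h
  apply key
  rw [ae_restrict_iff' measurableSet_Ioo] at h ⊢
  filter_upwards [h] with u hu huI
  rw [hdil u huI.1, hu huI]

/-- **THEOREM P, integral form.** Under the same hypotheses, `0 < ∫_{(0,δ]} ‖θ_F(u)‖² du` for
every `δ > 0`. -/
theorem setIntegral_normSq_dilationSum_pos (hlam : 0 < lam) {L : ℝ≥0}
    (hLip : LipschitzOnWith L F (Icc 0 lam)) (hFm : Measurable F) (hFs : ∀ x, lam < x → F x = 0)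
    (hint : ∫ t in (0 : ℝ)..lam, F t = 0) {x₀ : ℝ} (hx₀ : x₀ ∈ Ioc 0 lam) (hF : F x₀ ≠ 0)
    {δ : ℝ} (hδ : 0 < δ) :
    0 < ∫ u in Ioc 0 δ, ‖dilationSum lam F u‖ ^ 2 := by
  obtain ⟨M, hM⟩ : ∃ M, ∀ t ∈ Icc 0 lam, ‖F t‖ ≤ M :=
    isCompact_Icc.exists_bound_of_continuousOn hLip.continuousOn
  have hB := norm_dilationSum_le_of_lipschitzOn hlam hLip hM hFs hint
  have hGm : Measurable (fun u ↦ ‖dilationSum lam F u‖ ^ 2) :=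
    ((measurable_dilationSum hFm lam).norm).pow_const 2
  have hGi : IntegrableOn (fun u ↦ ‖dilationSum lam F u‖ ^ 2) (Ioc 0 δ) :=
    Measure.integrableOn_of_bounded (M := (L * lam + M) ^ 2) (by simp) hGm.aestronglyMeasurable
      (Eventually.of_forall fun u ↦ by
        rw [Real.norm_of_nonneg (by positivity)]
        exact pow_le_pow_left₀ (norm_nonneg _) (hB u) 2)
  by_contra hle
  have h0 : ∫ u in Ioc 0 δ, ‖dilationSum lam F u‖ ^ 2 = 0 :=
    le_antisymm (not_lt.mp hle) (integral_nonneg fun u ↦ by positivity)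
  have hae := (setIntegral_eq_zero_iff_of_nonneg_ae (Eventually.of_forall fun u ↦ by positivity)
    hGi).mp h0
  apply dilationSum_not_ae_zero_of_lipschitzOn hlam hLip hFm hFs hint hx₀ hF hδ
  have hae' : ∀ᵐ u ∂(volume.restrict (Ioo 0 δ)), ‖dilationSum lam F u‖ ^ 2 = 0 :=
    ae_restrict_of_ae_restrict_of_subset Ioo_subset_Ioc_self hae
  filter_upwards [hae'] with u hu
  simpa using hu

/-- **THEOREM P for the lattice tail `T_λ`.** For `λ ≥ 1` and `F` as above:
`0 < latticeTail λ F = ∫_0^{1/λ} ‖θ_F‖²`. So the deficit functional of the HANDOFF programme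
(THEOREM U0's `T_λ`, idea-1's (U-LATTICE)/(U-PW*)) vanishes for NO admissible vector — in
particular the fibrewise infimum `0` of THEOREM N (`= 0 ⟺ RH`) is never attained. -/
theorem latticeTail_pos (hlam : 1 ≤ lam) {L : ℝ≥0} (hLip : LipschitzOnWith L F (Icc 0 lam))
    (hFm : Measurable F) (hFs : ∀ x, lam < x → F x = 0) (hint : ∫ t in (0 : ℝ)..lam, F t = 0)
    {x₀ : ℝ} (hx₀ : x₀ ∈ Ioc 0 lam) (hF : F x₀ ≠ 0) :
    0 < latticeTail lam F :=
  setIntegral_normSq_dilationSum_pos (by linarith) hLip hFm hFs hint hx₀ hF (by positivity)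

/-! ## The even two-sided vectors of the programme -/

/-- For an even integrable `F` supported in `[-λ, λ]` with `∫_ℝ F = 0`: `∫_0^λ F = 0`. -/
theorem intervalIntegral_eq_zero_of_even (hlam : 0 ≤ lam) (heven : ∀ x, F (-x) = F x)
    (hFi : Integrable F) (hsupp : Function.support F ⊆ Icc (-lam) lam) (hmean : ∫ x, F x = 0) :
    ∫ t in (0 : ℝ)..lam, F t = 0 := by
  -- `∫_ℝ F = ∫_{(-∞,0]} F + ∫_{(0,∞)} F` and the two halves agree by evenness
  have hsplit : ∫ x, F x = (∫ x in Iic 0, F x) + ∫ x in Ioi 0, F x := by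
    rw [← setIntegral_union (Iic_disjoint_Ioi le_rfl) measurableSet_Ioi hFi.integrableOn
      hFi.integrableOn, Iic_union_Ioi, setIntegral_univ]
  have hneg : ∫ x in Iic 0, F x = ∫ x in Ioi 0, F x := by
    have h1 := integral_comp_neg_Ioi 0 F
    rw [neg_zero] at h1
    rw [← h1]
    exact setIntegral_congr_fun measurableSet_Ioi fun x _ ↦ heven x
  have hIoi : ∫ x in Ioi 0, F x = 0 := by
    have h2 := hmean
    rw [hsplit, hneg, ← two_mul] at h2
    exact (mul_eq_zero.mp h2).resolve_left two_ne_zero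
  -- `∫_{(0,∞)} F = ∫_{(0,λ]} F = ∫_0^λ F`
  have hFs : ∀ x, lam < x → F x = 0 := fun x hx ↦
    Function.notMem_support.mp fun h ↦ not_le.mpr hx (hsupp h).2
  rw [intervalIntegral.integral_of_le hlam, ← hIoi]
  symm
  refine setIntegral_eq_of_subset_of_forall_sdiff_eq_zero measurableSet_Ioi Ioc_subset_Ioi_self ?_
  intro x hx
  exact hFs x (not_le.mp fun h ↦ hx.2 ⟨hx.1, h⟩)

end LatticeUncertainty

end Summit.RiemannHypothesis.RiemannHypothesis.Theorems
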